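import Summits.QuantumFields.QCD.Theorems.QuarksAsStableActionCriticalLineDiamagnetismCheckerEvalDefs
import Summits.QuantumFields.QCD.Theorems.QuarksAsStableActionCriticalLineDiamagnetismCheckerSymm

/-!
# Block-margin certificate checker — soundness of the leaf test, part A (crux stmt-QuantumFields-9734, lead c3)

* bookkeeping: `lget_map_range`, `mem_asum_range` (sums of forms), `Cn`, `sgn_bitsFun`, `aW_bits`, `wS_bits`,
  `bitsFun_xor_nat` (shift addition is `xor` of masks);
* the noise vector of a point of a box is valid (`noise_valid`: `|ε_k| ≤ 1`) and the coordinate forms enclose the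
  coordinates (`mem_cForm`);
* **`mkCtx_sound`**: every shared form of a successfully built context encloses its real counterpart
  (`C_k`, `1 − C_k²`, `A(b)`, `1/h(b)`, tadpoles, `W(bs)`, `A A'`, `h⁻¹ h'⁻¹`, `C C`, `C S2`, `S2 S2`), by the
  inclusion theorems of `AffineArithmetic(Inv).lean`;
* the `θ → C` dictionary: `min(θ, π − θ) < ½ ↔ cos ½ < |cos θ|`, `¬(min < 1/20) → |cos θ| ≤ cos (1/20)`, whence
  `inRegion_cos`, `inRegion_cos_three` (the skeleton's `θ`-regions are the checker's `C`-regions).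

Pure theorem file; no definitions, no facts, no axioms.
-/

namespace Summit.QuantumFields.QCD.Cruxes.CriticalLineDiamagnetism.ChessboardCellGain.Checker

open Finset
/-! ## Soundness, part 2: the affine leaf test -/

section EvalSound

open Literature.Analysis.ValidatedNumerics

/-! ### List bookkeeping -/

/-- Access to a mapped range. -/
theorem lget_map_range {n : ℕ} (f : ℕ → AForm) {i : ℕ} (hi : i < n) :
    lget ((List.range n).map f) i = f i := by
  unfold lget
  rw [List.getD_eq_getElem?_getD, List.getElem?_map, List.getElem?_range hi]
  rfl

/-- Soundness of `asum` over a mapped list of indices. -/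
theorem mem_asum_map {S : ℕ} {ε : ℕ → ℝ} (hS : 0 < S) (f : ℕ → AForm) (v : ℕ → ℝ) :
    ∀ l : List ℕ, (∀ i ∈ l, AForm.mem S ε (v i) (f i)) → AForm.mem S ε ((l.map v).sum) (asum (l.map f))
  | [], _ => by
    simp only [List.map_nil, List.sum_nil, asum]
    have := AForm.mem_const (ε := ε) hS 0
    simpa using this
  | i :: l, h => by
    simp only [List.map_cons, List.sum_cons, asum]
    exact AForm.mem_add (h i List.mem_cons_self) (mem_asum_map hS f v l fun j hj => h j (List.mem_cons_of_mem _ hj))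

/-- Soundness of `asum` over a mapped `List.range`. -/
theorem mem_asum_range {S : ℕ} {ε : ℕ → ℝ} (hS : 0 < S) (n : ℕ) (f : ℕ → AForm) (v : ℕ → ℝ)
    (h : ∀ i < n, AForm.mem S ε (v i) (f i)) :
    AForm.mem S ε (∑ i ∈ Finset.range n, v i) (asum ((List.range n).map f)) := by
  have := mem_asum_map hS f v (List.range n) fun i hi => h i (List.mem_range.1 hi)
  rwa [← List.toFinset_range, List.sum_toFinset _ (List.nodup_range)]

/-! ### Real counterparts on `ℕ` indices -/

/-- `Cn` agrees with `C` on `Fin 4`. -/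
theorem Cn_fin (C : Fin 4 → ℝ) (k : Fin 4) : Cn C k = C k := by
  unfold Cn; rw [dif_pos k.2]

/-- The sign of a bit-mask class is `sgnZ`. -/
theorem sgn_bitsFun (b : ℕ) (k : Fin 4) : sgn (bitsFun b) k = (sgnZ b k : ℝ) := by
  unfold sgn bitsFun sgnZ
  by_cases h : b.testBit k.val
  · rw [if_pos h, if_pos h, ZMod.val_one]; norm_num
  · rw [if_neg h, if_neg h, ZMod.val_zero]; norm_num

/-- Sums over `Fin 4` as sums over `range 4`. -/
theorem sum_fin4_eq_sum_range (g : ℕ → ℝ) : ∑ κ : Fin 4, g κ = ∑ k ∈ Finset.range 4, g k :=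
  (Fin.sum_univ_eq_sum_range g 4)

/-- `A(b)` on `ℕ` indices. -/
theorem aW_bits (C : Fin 4 → ℝ) (b : ℕ) :
    aW C (bitsFun b) = 4 - ∑ k ∈ Finset.range 4, (sgnZ b k : ℝ) * Cn C k := by
  unfold aW
  rw [Finset.sum_sub_distrib, Finset.sum_const, Finset.card_univ, Fintype.card_fin]
  simp only [nsmul_eq_mul, Nat.cast_ofNat, mul_one]
  congr 1
  rw [← sum_fin4_eq_sum_range]
  exact Finset.sum_congr rfl fun κ _ => by rw [sgn_bitsFun, Cn_fin]

/-- `Σ S2` on `ℕ` indices. -/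
theorem sum_s2_eq (C : Fin 4 → ℝ) : ∑ κ : Fin 4, s2 C κ = ∑ k ∈ Finset.range 4, (1 - Cn C k ^ 2) := by
  rw [← sum_fin4_eq_sum_range]
  exact Finset.sum_congr rfl fun κ _ => by unfold s2; rw [Cn_fin]

/-- `W(bs)` on `ℕ` indices. -/
theorem wS_bits (C : Fin 4 → ℝ) (bs : ℕ) :
    wS C (bitsFun bs) = ∑ k ∈ Finset.range 4, (sgnZ bs k : ℝ) * (1 - Cn C k ^ 2) := by
  unfold wS
  rw [← sum_fin4_eq_sum_range]
  exact Finset.sum_congr rfl fun κ _ => by unfold s2; rw [sgn_bitsFun, Cn_fin]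

/-- Shift addition is `xor` of masks (`ℕ` version). -/
theorem bitsFun_xor_nat {b bs : ℕ} (hb : b < 16) (hbs : bs < 16) :
    bitsFun b + bitsFun bs = bitsFun (b ^^^ bs) :=
  (bitsFun_xor ⟨b, hb⟩ ⟨bs, hbs⟩).symm

/-- `xor` of two masks below `16` is below `16`. -/
theorem xor_lt_16 {b bs : ℕ} (hb : b < 16) (hbs : bs < 16) : b ^^^ bs < 16 :=
  Nat.xor_lt_two_pow (n := 4) hb hbs

/-! ### The noise vector of a point in a box -/

/-- The coordinate form is the `var` of centre and half-width. -/
theorem cForm_eq (B : IBox) (k : ℕ) : cForm B k = AForm.var (B.cen k) (B.hw k) k := rfl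

/-- A coordinate of a point of a box is within the half-width of the centre (scaled). -/
theorem abs_sub_cen_le {B : IBox} {C : Fin 4 → ℝ} (hC : IBox.mem SC B C) {k : ℕ} (hk : k < 4) :
    |Cn C k * SC - (B.cen k : ℝ)| ≤ (B.hw k : ℝ) := by
  obtain ⟨h1, h2⟩ := hC.out ⟨k, hk⟩
  unfold Cn; rw [dif_pos hk]
  unfold IBox.hw IBox.cen
  set lo := (B.ivl k).1
  set hi := (B.ivl k).2
  have hm : (lo + hi) / 2 * 2 ≤ lo + hi := Int.ediv_mul_le _ (by norm_num)
  have hm' : lo + hi < ((lo + hi) / 2 + 1) * 2 := Int.lt_ediv_add_one_mul_self _ (by norm_num)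
  have e1 : (((lo + hi) / 2 * 2 : ℤ) : ℝ) ≤ ((lo + hi : ℤ) : ℝ) := by exact_mod_cast hm
  have e2 : ((lo + hi : ℤ) : ℝ) < ((((lo + hi) / 2 + 1) * 2 : ℤ) : ℝ) := by exact_mod_cast hm'
  push_cast at e1 e2 ⊢
  rw [abs_le]
  constructor <;> linarith

/-- The noise vector of a point of a box is valid: `|ε_k| ≤ 1`. -/
theorem noise_valid (B : IBox) (C : Fin 4 → ℝ) (hC : IBox.mem SC B C) : AForm.Valid (noise B C) := by
  intro k
  unfold noise
  split_ifs with hk hw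
  · simp
  · have hb := abs_sub_cen_le hC hk
    have hwpos : (0 : ℝ) < (B.hw k : ℝ) := by
      have h0 : (0 : ℝ) ≤ (B.hw k : ℝ) := (abs_nonneg _).trans hb
      rcases h0.lt_or_eq with h | h
      · exact h
      · exact absurd (by exact_mod_cast h.symm) hw
    rw [abs_div, abs_of_pos hwpos, div_le_one hwpos]
    exact hb
  · simp

/-- The coordinate forms enclose the coordinates. -/
theorem mem_cForm {B : IBox} {C : Fin 4 → ℝ} (hC : IBox.mem SC B C) {k : ℕ} (hk : k < 4) :
    AForm.mem SC (noise B C) (Cn C k) (cForm B k) := by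
  have hv := AForm.mem_var (ε := noise B C) (by decide : 0 < SC) (B.cen k) (B.hw k) k
  rw [cForm_eq]
  convert hv using 1
  have hS : (SC : ℝ) ≠ 0 := by exact_mod_cast (by decide : 0 < SC).ne'
  rw [eq_div_iff hS]
  unfold noise
  rw [if_pos hk]
  split_ifs with hw
  · -- zero half-width: the coordinate is pinned to the centre
    have hb := abs_sub_cen_le hC hk
    rw [hw, Int.cast_zero] at hb
    have := abs_nonpos_iff.1 hb
    push_cast [hw]
    linarith
  · have hw' : (B.hw k : ℝ) ≠ 0 := by exact_mod_cast hw
    field_simp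
    ring

/-! ### Soundness of the context -/

/-- Index arithmetic for `16 b + b'`. -/
theorem div16 {b b' : ℕ} (hb' : b' < 16) : (16 * b + b') / 16 = b ∧ (16 * b + b') % 16 = b' := by omega
/-- Index arithmetic for `4 μ + ν`. -/
theorem div4 (μ ν : Fin 4) : (4 * (μ : ℕ) + ν) / 4 = μ ∧ (4 * (μ : ℕ) + ν) % 4 = ν := by omega

/-- **Soundness of `mkCtx`**. -/
theorem mkCtx_sound {B : IBox} {X : Ctx} (hX : mkCtx B = some X) {C : Fin 4 → ℝ} (hC : IBox.mem SC B C) :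
    CtxSound X C (noise B C) := by
  set ε := noise B C with hε
  have hval : AForm.Valid ε := noise_valid B C hC
  -- unfold the successful branch of `mkCtx`
  unfold mkCtx at hX
  simp only at hX
  split_ifs at hX with hall
  simp only [Option.some.injEq] at hX
  -- name the lists
  set cs := (List.range 4).map (cForm B) with hcs
  set qs := (List.range 4).map fun k => AForm.sub (AForm.const SC) (AForm.sq SC (lget cs k)) with hqs
  set as := (List.range 16).map fun b =>
    AForm.sub (AForm.const (4 * SC)) (asum ((List.range 4).map fun k => AForm.mulInt (sgnZ b k) (lget cs k))) with has
  set ihs? := (List.range 16).map fun b => AForm.inv SC (AForm.add (AForm.sq SC (lget as b)) (asum qs)) with hihs?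
  set ihs := ihs?.map fun o => o.getD (AForm.const 0) with hihs
  -- (1) coordinates
  have hc : ∀ k < 4, AForm.mem SC ε (Cn C k) (lget cs k) := fun k hk => by
    rw [hcs, lget_map_range _ hk]; exact mem_cForm hC hk
  -- (2) `1 − C²`
  have h1 : AForm.mem SC ε (1 : ℝ) (AForm.const SC) := by
    have := AForm.mem_const (ε := ε) (by decide : 0 < SC) (SC : ℤ)
    rwa [Int.cast_natCast, div_self (by exact_mod_cast (by decide : 0 < SC).ne' : (SC : ℝ) ≠ 0)] at this
  have hq : ∀ k < 4, AForm.mem SC ε (1 - Cn C k ^ 2) (lget qs k) := fun k hk => by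
    rw [hqs, lget_map_range _ hk]
    exact AForm.mem_sub h1 (AForm.mem_sq (by decide : 0 < SC) hval (hc k hk))
  have hsumq : AForm.mem SC ε (∑ κ : Fin 4, s2 C κ) (asum qs) := by
    rw [sum_s2_eq, hqs]
    exact mem_asum_range (by decide : 0 < SC) 4 _ (fun k => 1 - Cn C k ^ 2) fun k hk => by
      have := hq k hk; rwa [hqs, lget_map_range _ hk] at this
  -- (3) `A(b)`
  have h4 : AForm.mem SC ε (4 : ℝ) (AForm.const (4 * SC)) := by
    have := AForm.mem_const (ε := ε) (by decide : 0 < SC) (4 * SC : ℤ)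
    have hS : (SC : ℝ) ≠ 0 := by exact_mod_cast (by decide : 0 < SC).ne'
    rwa [show (((4 * SC : ℤ)) : ℝ) / SC = 4 by push_cast; field_simp] at this
  have ha : ∀ b < 16, AForm.mem SC ε (aW C (bitsFun b)) (lget as b) := fun b hb => by
    rw [has, lget_map_range _ hb, aW_bits]
    exact AForm.mem_sub h4 (mem_asum_range (by decide : 0 < SC) 4 _ (fun k => (sgnZ b k : ℝ) * Cn C k)
      fun k hk => AForm.mem_mulInt _ (hc k hk))
  -- (4) `1/h(b)`
  have hh : ∀ b < 16, AForm.mem SC ε (hW C (bitsFun b)) (AForm.add (AForm.sq SC (lget as b)) (asum qs)) :=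
    fun b hb => by
      unfold hW
      exact AForm.mem_add (AForm.mem_sq (by decide : 0 < SC) hval (ha b hb)) hsumq
  have hih : ∀ b < 16, AForm.mem SC ε (hW C (bitsFun b))⁻¹ (lget ihs b) := fun b hb => by
    have hsome : (AForm.inv SC (AForm.add (AForm.sq SC (lget as b)) (asum qs))).isSome = true := by
      rw [List.all_eq_true] at hall
      have := hall (AForm.inv SC (AForm.add (AForm.sq SC (lget as b)) (asum qs)))
        (by rw [hihs?]; exact List.mem_map.2 ⟨b, List.mem_range.2 hb, rfl⟩)
      exact this
    obtain ⟨G, hG⟩ := Option.isSome_iff_exists.1 hsome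
    have e : lget ihs b = G := by
      rw [hihs, hihs?, List.map_map]
      rw [lget_map_range _ hb]
      simp [Function.comp, hG]
    rw [e]
    exact AForm.mem_inv (by decide : 0 < SC) hval hG (hh b hb)
  -- assemble the eleven families
  rw [← hX]
  refine ⟨hc, hq, ha, hih, ?_, ?_, ?_, ?_, ?_, ?_, ?_⟩
  · -- tadpoles
    intro μ
    rw [lget_map_range _ μ.2, sum_class_eq_sum_range]
    refine mem_asum_range (by decide : 0 < SC) 16 _ (fun b => 2 * (s2 C μ - aW C (bitsFun b) * (sgn (bitsFun b) μ * C μ)) /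
      hW C (bitsFun b)) fun b hb => ?_
    rw [div_eq_mul_inv]
    rw [show (2 : ℝ) * (s2 C μ - aW C (bitsFun b) * (sgn (bitsFun b) μ * C μ)) * (hW C (bitsFun b))⁻¹ =
      ((2 : ℤ) : ℝ) * ((s2 C μ - aW C (bitsFun b) * (sgn (bitsFun b) μ * C μ)) * (hW C (bitsFun b))⁻¹) by
      push_cast; ring]
    refine AForm.mem_mulInt 2 (AForm.mem_mul (by decide : 0 < SC) hval (AForm.mem_sub ?_ ?_) (hih b hb))
    · have := hq μ μ.2; unfold s2; rwa [Cn_fin] at this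
    · rw [sgn_bitsFun, show aW C (bitsFun b) * ((sgnZ b μ : ℝ) * C μ) =
        aW C (bitsFun b) * ((sgnZ b μ : ℤ) * Cn C μ) by rw [Cn_fin]]
      exact AForm.mem_mul (by decide : 0 < SC) hval (ha b hb) (AForm.mem_mulInt _ (hc μ μ.2))
  · -- W
    intro bs hbs
    rw [lget_map_range _ hbs, wS_bits]
    exact mem_asum_range (by decide : 0 < SC) 4 _ (fun k => (sgnZ bs k : ℝ) * (1 - Cn C k ^ 2)) fun k hk =>
      AForm.mem_mulInt _ (hq k hk)
  · -- AA'
    intro b hb b' hb'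
    have ht : 16 * b + b' < 256 := by omega
    rw [lget_map_range _ ht, (div16 hb').1, (div16 hb').2]
    exact AForm.mem_mul (by decide : 0 < SC) hval (ha b hb) (ha b' hb')
  · -- ih ih'
    intro b hb b' hb'
    have ht : 16 * b + b' < 256 := by omega
    rw [lget_map_range _ ht, (div16 hb').1, (div16 hb').2]
    exact AForm.mem_mul (by decide : 0 < SC) hval (hih b hb) (hih b' hb')
  · intro μ ν
    have ht : 4 * (μ : ℕ) + ν < 16 := by omega
    rw [lget_map_range _ ht, (div4 μ ν).1, (div4 μ ν).2, ← Cn_fin C μ, ← Cn_fin C ν]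
    exact AForm.mem_mul (by decide : 0 < SC) hval (hc μ μ.2) (hc ν ν.2)
  · intro μ ν
    have ht : 4 * (μ : ℕ) + ν < 16 := by omega
    rw [lget_map_range _ ht, (div4 μ ν).1, (div4 μ ν).2, ← Cn_fin C μ]
    unfold s2; rw [← Cn_fin C ν]
    exact AForm.mem_mul (by decide : 0 < SC) hval (hc μ μ.2) (hq ν ν.2)
  · intro μ ν
    have ht : 4 * (μ : ℕ) + ν < 16 := by omega
    rw [lget_map_range _ ht, (div4 μ ν).1, (div4 μ ν).2]
    unfold s2; rw [← Cn_fin C μ, ← Cn_fin C ν]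
    exact AForm.mem_mul (by decide : 0 < SC) hval (hq μ μ.2) (hq ν ν.2)



end EvalSound

/-- **Registered helper `stub_checkerMkCtxSound`** (= `mkCtx_sound`). -/
theorem stub_checkerMkCtxSound : ∀ (B : IBox) (X : Ctx), mkCtx B = some X → ∀ (C : Fin 4 → ℝ), IBox.mem SC B C → CtxSound X C (noise B C) :=
  fun _ _ hX _ hC => mkCtx_sound hX hC
/-! ### From block twists `θ ∈ (0,π)⁴` to the `C`-regions -/

section Theta

/-- `|cos x| = cos (min x (π − x))` on `(0, π)`. -/
theorem abs_cos_eq_cos_min {x : ℝ} (hx : 0 < x ∧ x < Real.pi) :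
    |Real.cos x| = Real.cos (min x (Real.pi - x)) := by
  rcases le_total x (Real.pi / 2) with h | h
  · rw [min_eq_left (by linarith), abs_of_nonneg (Real.cos_nonneg_of_neg_pi_div_two_le_of_le (by linarith) h)]
  · rw [min_eq_right (by linarith), Real.cos_pi_sub,
      abs_of_nonpos (Real.cos_nonpos_of_pi_div_two_le_of_le h (by linarith))]

/-- `min x (π − x) ∈ [0, π]` on `(0, π)`. -/
theorem min_mem_Icc {x : ℝ} (hx : 0 < x ∧ x < Real.pi) : min x (Real.pi - x) ∈ Set.Icc 0 Real.pi := by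
  constructor
  · exact le_min hx.1.le (by linarith)
  · exact (min_le_left _ _).trans hx.2.le

/-- `½ ∈ [0, π]`. -/
theorem half_mem_Icc : (1 / 2 : ℝ) ∈ Set.Icc 0 Real.pi := ⟨by norm_num, by linarith [Real.pi_gt_three]⟩

/-- `1/20 ∈ [0, π]`. -/
theorem twentieth_mem_Icc : (1 / 20 : ℝ) ∈ Set.Icc 0 Real.pi := ⟨by norm_num, by linarith [Real.pi_gt_three]⟩

/-- Collar coordinates: `min(θ, π − θ) < ½ ↔ cos ½ < |cos θ|`. -/
theorem min_lt_half_iff {x : ℝ} (hx : 0 < x ∧ x < Real.pi) :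
    min x (Real.pi - x) < 1 / 2 ↔ Real.cos (1 / 2) < |Real.cos x| := by
  rw [abs_cos_eq_cos_min hx]
  exact (Real.strictAntiOn_cos.lt_iff_gt half_mem_Icc (min_mem_Icc hx)).symm

/-- Outside the corner collar: `¬ (min(θ, π − θ) < 1/20) → |cos θ| ≤ cos (1/20)`. -/
theorem abs_cos_le_of_not_lt {x : ℝ} (hx : 0 < x ∧ x < Real.pi) (h : ¬ min x (Real.pi - x) < 1 / 20) :
    |Real.cos x| ≤ Real.cos (1 / 20) := by
  rw [abs_cos_eq_cos_min hx]
  exact (Real.strictAntiOn_cos.le_iff_ge (min_mem_Icc hx) twentieth_mem_Icc).2 (not_lt.1 h)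

/-- The collar count of `cos ∘ θ` is the skeleton's count of coordinates with `min(θ, π − θ) < ½`. -/
theorem nNear_cos (θ : Fin 4 → ℝ) (hθ : ∀ μ, 0 < θ μ ∧ θ μ < Real.pi) :
    nNear (fun κ => Real.cos (θ κ)) =
      (Finset.univ.filter fun μ : Fin 4 => min (θ μ) (Real.pi - θ μ) < 1 / 2).card := by
  unfold nNear
  congr 1
  exact Finset.filter_congr fun μ _ => (min_lt_half_iff (hθ μ)).symm

/-- The `θ`-regions of the skeleton are the `C`-regions of the checker (`r ≤ 2`). -/
theorem inRegion_cos {r : ℕ} (hr : r < 3) (θ : Fin 4 → ℝ) (hθ : ∀ μ, 0 < θ μ ∧ θ μ < Real.pi)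
    (hcard : (Finset.univ.filter fun μ : Fin 4 => min (θ μ) (Real.pi - θ μ) < 1 / 2).card = r) :
    InRegion r (fun κ => Real.cos (θ κ)) := by
  refine ⟨fun κ => Real.abs_cos_le_one _, ?_⟩
  rw [if_pos hr, nNear_cos θ hθ, hcard]

/-- The `θ`-region P3a is the `C`-region `3` of the checker. -/
theorem inRegion_cos_three (θ : Fin 4 → ℝ) (hθ : ∀ μ, 0 < θ μ ∧ θ μ < Real.pi)
    (hcard : 3 ≤ (Finset.univ.filter fun μ : Fin 4 => min (θ μ) (Real.pi - θ μ) < 1 / 2).card)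
    (hnc : ¬ (∀ μ : Fin 4, min (θ μ) (Real.pi - θ μ) < 1 / 20)) :
    InRegion 3 (fun κ => Real.cos (θ κ)) := by
  refine ⟨fun κ => Real.abs_cos_le_one _, ?_⟩
  rw [if_neg (lt_irrefl 3), nNear_cos θ hθ]
  refine ⟨hcard, ?_⟩
  push Not at hnc
  obtain ⟨μ, hμ⟩ := hnc
  exact ⟨μ, abs_cos_le_of_not_lt (hθ μ) (not_lt.2 hμ)⟩

end Theta

end Summit.QuantumFields.QCD.Cruxes.CriticalLineDiamagnetism.ChessboardCellGain.Checker
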